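import Summits.MatrixMultiplication.OmegaCensus.DominoZpZpCover
import Summits.MatrixMultiplication.OmegaCensus.DominoZ5LineTable8A
import Summits.MatrixMultiplication.OmegaCensus.DominoZ5LineTable8B
import HarnessLib

/-!
# Kernel covers on `ZMod 5 × ZMod 5`: part `8` (A: search tree, soundness, chunks 0–2)

ω-census `pub-omega`, family (b3), seat pub-omega-group gen 20.  Framing: lottery ticket; floor = certified bounds/negative
ranges.  VALUE: the finite kernel computation behind the `ℤ_5 × ℤ_5` domino cell theorems with a part `8` (`DominoZ5Z5Part8.lean`); NOT progress on ω.

Instances of the generic margin-pruned enumeration `DominoZpZpCover.lean`: per part size `d`, the search tree of the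
codes of the UNcertified 1-D multisets (`passTree…`, untrusted), its extensional soundness against the certified table
(`…_sound`, `decide`), the kernel cover computations (`cover_…`, `decide`; normal form (i) chunked), and the assembled
semantic statement `exists_table_entry_5_8` consumed by the cell theorems.  Enumeration sizes (leaves / nodes, exact
Python twin `pub-omega-group-g20/code/emulate.py`): normal form (i) 142 025 / 193 239 in 9 chunks (key `polyBE 2 R % 9`): 23 925, 11 375, 18 625, 18 850, 14 375, 22 375, 10 000, 10 875, 11 625 leaves; files A (chunks 0–2), B (3–5), C (6–8, axis forms); B and C both import A only; the assembly `exists_table_entry_5_8` lives in `DominoZ5Z5Part8.lean`.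
-/

namespace Summit.MatrixMultiplication.OmegaCensus

namespace ZpZpDomino

/-- The certified table for part `8` (gen 19, two files). [folklore] -/
abbrev tableZ5d8 : List (List ℕ × List (ℕ × List ℕ)) := table8a ++ table8b

/-- Search tree of the codes `polyBE 9 c` of the 44 UNcertified multisets `c` of size 8 on `ZMod 5`
(complement of the certified table; 495 multisets in all); untrusted, see `passTreeZ5d8_sound`. [folklore] -/
def passTreeZ5d8 : BTree := BTree.ofList [
  13872, 8120, 6680, 1648, 1560, 992, 6672, 2360, 7464, 7456, 7400, 7536, 7472, 8848, 8272, 8200, 8192, 8776, 8352,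
  13224, 9496, 9000, 13376, 15400, 14104, 13960, 13952, 13944, 14096, 14024, 14688, 14680, 14608, 14752, 20424,
  19704, 15480, 15472, 19936, 19928, 21952, 21168, 20520, 22032]

set_option maxHeartbeats 4000000 in
/-- The ONLY fact used about `passTreeZ5d8`: a composition of `8` whose code is unflagged is the key of a table entry
(kernel check over all 495 compositions). [folklore] -/
theorem passTreeZ5d8_sound : soundChk 5 8 passTreeZ5d8 tableZ5d8 = true := by decide +kernel

set_option maxHeartbeats 4000000 in
/-- Kernel cover computation, `p = 5`, `d = 8`, normal form (i), chunk `0` of `9`. [folklore] -/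
theorem cover_5_8_nf1_0 : coverNF1 5 8 passTreeZ5d8 2 9 0 = true := by decide +kernel

set_option maxHeartbeats 4000000 in
/-- Kernel cover computation, `p = 5`, `d = 8`, normal form (i), chunk `1` of `9`. [folklore] -/
theorem cover_5_8_nf1_1 : coverNF1 5 8 passTreeZ5d8 2 9 1 = true := by decide +kernel

set_option maxHeartbeats 4000000 in
/-- Kernel cover computation, `p = 5`, `d = 8`, normal form (i), chunk `2` of `9`. [folklore] -/
theorem cover_5_8_nf1_2 : coverNF1 5 8 passTreeZ5d8 2 9 2 = true := by decide +kernel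

end ZpZpDomino

end Summit.MatrixMultiplication.OmegaCensus
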